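/-
Copyright (c) 2026 the pub-hodgecm-mathlib formalisation cell (harness21).  Prover seat hodgecm-mathlib-K2E3-p37 (g2), Track B «K2-LIT» ∕ h413 =
`stmt-HodgeConjecture-24833`, line `K2_E3_EllipticInputs`, unit U4 «Keys», PART «U4Keys» socket :182 (U4f-χ₁-ram-one-pos)
`sig_K2E3KeysThmTwoContractingRamifiedCharOnePosDepth` (L4 line-lead K2E3-plan (g5); regime A_pos over the two-depth group `J_e`; brick (B2) of this seat's memo
`K2/K2E3-p37/g2/MEMO-PosA-Recut.K2E3-p37-g2.md`): «THE LETTER `hwit` ON THE LOWER INTERMEDIATE CELLS OF `J_e`, CM DRESS» — ★ p862401 §2 (R90-C10-p02 (g2)'s transport of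
★ p862149, trace-one form) re-run with `J_{m+1} ↦ J_e` over the cover ★ p862713 (families X ∪ Z of ★ p862593, both exact-conductor witnesses).  REPORT-FIRST 2026-09-04.
-/
import Summits.HodgeConjecture.HodgeConjecture.Theorems.K2E3LevelNDepthWitnessCM          -- ★ p862149 (R90-C10-p02 (g2)): `symm_mem_N_of_mem_unipotentU`, `tau_apply_one_eq_one_of_mem_N`; brings ★ Z2A-3b (`coe_eA_apply`, `isUnit_of_apply_ne_zero`, `map_mem_map_of_mem_map`), ★ `conjLocal_apply_eq_of_smul_eq`
import Summits.HodgeConjecture.HodgeConjecture.Theorems.K2E3TwoDepthDepthWitnessCover   -- ★ p862713 (this seat): `exists_depth_witness_twoDepth`, `not_le_and_le_of_not_mem_twoDepth`; brings ★ p862593, ★ D174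
import Summits.HodgeConjecture.HodgeConjecture.Theorems.K2E3LowerUnipotentDeepCellCM      -- ★ p862590 (K2E3-p34 (g2)): the letter `(Je) (hJe : Je = Jg.comap eA)`, `symm_mem_comap_of_mem`
import HarnessLib

/-!
# K2 ∕ E3 «EllipticInputs», unit U4 «Keys» — (U4f-χ₁-ram-one-pos), regime A_pos over `J_e`: THE CM LETTER `hwit` ON THE LOWER INTERMEDIATE CELLS OF THE TWO-DEPTH GROUP
# «★ p862149 ∕ ★ p862401 with `J_{m+1} ↦ J_e = eA⁻¹(Jg)` and the cover ★ p862713: every `r ∈ N̄ ∖ J_e` with `|(eA r)₂₀|_w ≤ 1` off the sharp big cell carries `b₀ ∈ J_e`, `r b₀ r⁻¹ ∈ P`, `θ(b₀) ≠ 1`»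
# [Roche1998 §3–§4; Casselman1995 §6.3; Rogawski1990 §1.10, §12.1; MoyPrasad1996 §3; BruhatTits1972 (6.4.9)]

Cell hodgecm-mathlib, Track B «K2-LIT», crux item H413 = stmt-HodgeConjecture-24833 (route `HCCMUnconditional`, no route verbs); target BY NAME the OPEN tier-0 leaf
`…K2E3EllipticInputs.U4Keys.sig_K2E3KeysThmTwoContractingRamifiedCharOnePosDepth` (U4Keys ED. 8 :182), design D-I «vanishing functional» at POSITIVE depth over Roche's
two-depth group (A_pos: cond_E `χ₁ = m + 1`, cond_F `χ₁ = k + 1 ≤ m + 1`, both branches `=` and `<` at once).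
Author K2E3-p37 (g2).  `--supports stmt-HodgeConjecture-24833 --as helper`; THEOREMS ONLY.  NOT THE PAYER (brick (B2) of the pos-A brick list; (B3) assembly consumes it).

THE POINT.  ★ p862149 (uniform `J_{m+1}`, `|2|_w = 1`) ∕ ★ p862401 (trace-one) dress the model depth witnesses as the engine ★ p861573's letter `hwit` on the intermediate cells.
This file is the same transport for the TWO-DEPTH group `J_e`, `e = (r₁, s₁; r₂, s₂)` (letters `(Jg, hJg)` of ★ D174 on the one-place model, `Je = Jg.comap eA` of ★ p862590 on
`U(Φ₃)(L⁺_v)`), over the cover ★ p862713: frame `v` non-split, `w ∣ v`, `eA`, uniformiser `ϖ`, `w₀` of matrix `Φ₃`; exponents `r₁ + r₂ = m + 1`, `s₁ + s₂ = k + 1`, `k ≤ m`,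
`1 ≤ m`, `|r₁ − r₂| ≤ 1`, `|s₁ − s₂| ≤ 1`, aligned; a trace-one `t ∈ L_w`; `χ₁` with `hcond` at depth `m + 1` (★ p861880's shape) and TWO exact-conductor witnesses: `u₁` (any unit,
`|(u₁)_{w′} − 1| ≤ |ϖ|ᵐ`, `χ₁ u₁ ≠ 1`: cond_E) and `u₂` (`σ u₂ = u₂`, `|(u₂)_{w′} − 1| ≤ |ϖ|ᵏ`, `χ₁ u₂ ≠ 1`: cond_F).  Then every `r ∈ N̄ = N.map (conj w₀)` with `|(eA r)₂₀|_w ≤ 1`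
(chart (I): the integral lower unipotents, the layer `|z| = 1` included), `r ∉ Je`, and `eA r` off the sharp big cell (★ p862537's letters negated: `¬(|x∕z| ≤ |ϖ|^{r₁} ∧
|ϖ|^{−s₁} ≤ |z|)` on the entries `x = (eA r)₂₁`, `z = (eA r)₂₀`) carries `b₀ ∈ Je` with `r b₀ r⁻¹ ∈ P` and `θ(b₀) ≠ (((1 ⊗ (χ₁, 1)) ∘ proj) ⊗ δ^{1∕2})(r b₀ r⁻¹)·1`
(`θ(b₀) = χ₁ u₁` or `χ₁ u₂`, right-hand side `1`).  Proof = p02's transport verbatim (`b₀ := r⁻¹·eA⁻¹(u)·r`), the one new step being the unit `(b₀)₀₀`: its `w`-component is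
`(u₀)_w (1 + ε) ≠ 0` (`u₀ ∈ {u₁, u₂}` a unit of `Π L_{w′}`, `|ε| < 1`), ★ `isUnit_of_apply_ne_zero`.
* §1 **`exists_depthWitness_twoDepth_of_mem_map_of_not_mem`**.
HONEST LABEL: HC_CM is proved only modulo the 7 printed citations (2 remaining named inputs: hLiu418 = stmt-HodgeConjecture-24832, h413 = stmt-HodgeConjecture-24833)
until rung 0 closes; count-neutral — this file does NOT pay the leaf; no printed citation is discharged.

## References
* [Roche1998] A. Roche, *Types and Hecke algebras for principal series representations of split reductive p-adic groups*, Ann. Sci. ÉNS (4) 31 (1998), §3–§4.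
* [Casselman1995] W. Casselman, *Introduction to the theory of admissible representations of `p`-adic reductive groups* (1995), §6.3.
* [Rogawski1990] J. D. Rogawski, *Automorphic Representations of Unitary Groups in Three Variables*, Ann. of Math. Stud. 123 (1990), §1.10 p. 9, §12.1 p. 171.
* [MoyPrasad1996] A. Moy, G. Prasad, *Jacquet functors and unrefined minimal K-types*, Comment. Math. Helv. 71 (1996), §3.
* [BruhatTits1972] F. Bruhat, J. Tits, *Groupes réductifs sur un corps local I*, Publ. Math. IHÉS 41 (1972), (6.4.9).
* [BernsteinZelevinsky1977] I. N. Bernstein, A. V. Zelevinsky, *Induced representations of reductive 𝔭-adic groups. I*, Ann. Sci. ÉNS 10 (1977), §1.8.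
-/

set_option autoImplicit false
-- the mandated namespace repeats the single-problem summit's segment (`HodgeConjecture.HodgeConjecture`)
set_option linter.dupNamespace false

noncomputable section

open NumberField IsDedekindDomain
open scoped Matrix MatrixGroups WithZero Valued
open Literature.NumberTheory Literature.NumberTheory.Automorphic Literature.NumberTheory.Automorphic.UnitaryGroup
open Literature.NumberTheory.Rogawski1990

namespace Summit.HodgeConjecture.HodgeConjecture.Cruxes.H413.K2E3TwoDepthDepthWitnessCM

open Summit.HodgeConjecture.HodgeConjecture.Cruxes.H413
open Summit.HodgeConjecture.HodgeConjecture.Cruxes.H413.K2E3DepthZeroIwahoriCharacterCM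
open Summit.HodgeConjecture.HodgeConjecture.Cruxes.H413.K2E3BranchATorusWitnessCM
open Summit.HodgeConjecture.HodgeConjecture.Cruxes.H413.K2E3LevelNDepthWitnessCM

variable (L : Type) [Field L] [NumberField L] [IsCMField L] (v : HeightOneSpectrum (𝓞 ↥(maximalRealSubfield L)))
  (w : PlacesOver L v) (hw : IsCMField.complexConj L • w.1 = w.1)
  (eA : Gqs L v ≃ₜ* ↥(unitaryGroupOfForm (galAdicCompletionMap (L := L) (IsCMField.complexConj L) hw) ((StdForm.antidiagonal 3).over (w.1.adicCompletion L))))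
  (heA : ∀ g : Gqs L v,
    ((eA g : ↥(unitaryGroupOfForm (galAdicCompletionMap (L := L) (IsCMField.complexConj L) hw) ((StdForm.antidiagonal 3).over (w.1.adicCompletion L)))) :
        GL (Fin 3) (w.1.adicCompletion L)) =
      ((localNonsplitEquiv (IsCMField.complexConj L) (qsForm L) (IsCMField.complexConj_ne_one L) w hw g :
        ↥(unitaryGroupOfForm (galAdicCompletionMap (L := L) (IsCMField.complexConj L) hw) (placeForm (qsForm L) w.1))) : GL (Fin 3) (w.1.adicCompletion L)))
  {ϖ : w.1.adicCompletion L} (hϖ : Valued.v ϖ = WithZero.exp (-1 : ℤ))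
  (r₁ s₁ r₂ s₂ : ℕ) (Jg : Subgroup ↥(unitaryGroupOfForm (galAdicCompletionMap (L := L) (IsCMField.complexConj L) hw) ((StdForm.antidiagonal 3).over (w.1.adicCompletion L))))
  (hJg : ∀ k : ↥(unitaryGroupOfForm (galAdicCompletionMap (L := L) (IsCMField.complexConj L) hw) ((StdForm.antidiagonal 3).over (w.1.adicCompletion L))),
    k ∈ Jg ↔ ∀ i j, Valued.v (((k : GL (Fin 3) (w.1.adicCompletion L)) : Matrix (Fin 3) (Fin 3) (w.1.adicCompletion L)) i j) ≤
      Valued.v ϖ ^ (![![0, r₁, s₁], ![r₂, 0, r₁], ![s₂, r₂, 0]] : Fin 3 → Fin 3 → ℕ) i j)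
  (Je : Subgroup (Gqs L v)) (hJe : Je = Jg.comap eA.toMulEquiv.toMonoidHom)
  (w₀ : Gqs L v) (hw₀ : Units.val (w₀.val : GL (Fin 3) (LocalRing L v)) = cmLocalForm L 3 v)

/-! ## §1 The CM letter `hwit` on a lower intermediate cell of `J_e` -/

open Classical in
include hw heA hϖ hJg hJe hw₀ in
set_option maxHeartbeats 1600000 in
-- as ★ p862149: the `U(Φ₃)(L⁺_v)`-valued products are read in two definitionally equal carriers (`Gqs L v` and the matrix subgroup); unification is slow
/-- **THE LETTER `hwit` ON A LOWER INTERMEDIATE CELL OF THE TWO-DEPTH GROUP (CM).**  See the module docstring for the frame and letters.  For `r ∈ N̄ = N.map (conj w₀)` with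
`|(eA r)₂₀|_w ≤ 1`, `r ∉ Je` and `eA r` off the sharp big cell, there is `b₀ ∈ Je` with `r b₀ r⁻¹ ∈ P` and
`θ(b₀) ≠ (((1 ⊗ (χ₁, 1)) ∘ proj) ⊗ δ^{1∕2})(r b₀ r⁻¹)·1` (`θ(g) = if IsUnit g₀₀ then χ₁(unit g₀₀) else 0`).  ★ p862713 (cover) through p02's transport ★ p862149∕p862401.
[cite: Roche1998, §3–§4] [cite: Casselman1995, §6.3] [cite: Rogawski1990, §1.10 p. 9] [cite: Rogawski1990, §12.1 p. 171] [cite: MoyPrasad1996, §3] -/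
theorem exists_depthWitness_twoDepth_of_mem_map_of_not_mem {m k : ℕ} (hm : 1 ≤ m) (hkm : k ≤ m) (hrr : r₁ + r₂ = m + 1) (hss : s₁ + s₂ = k + 1)
    (hr1 : r₁ ≤ r₂ + 1) (hr2 : r₂ ≤ r₁ + 1) (hs1 : s₁ ≤ s₂ + 1) (hs2 : s₂ ≤ s₁ + 1) (hal : (r₁ ≤ r₂ ∧ s₁ ≤ s₂) ∨ (r₂ ≤ r₁ ∧ s₂ ≤ s₁))
    {t : w.1.adicCompletion L} (ht : t + galAdicCompletionMap (L := L) (IsCMField.complexConj L) hw t = 1) (hvt : Valued.v t ≤ 1)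
    (χ₁ : (LocalRing L v)ˣ →* ℂˣ)
    (hcond : ∀ u : (LocalRing L v)ˣ, (∀ w' : PlacesOver L v, Valued.v (((u : LocalRing L v) w') - 1) ≤ Valued.v ϖ ^ (m + 1)) → χ₁ u = 1)
    (u₁ : (LocalRing L v)ˣ) (hu₁ : ∀ w' : PlacesOver L v, Valued.v (((u₁ : LocalRing L v) w') - 1) ≤ Valued.v ϖ ^ m) (hχu₁ : χ₁ u₁ ≠ 1)
    (u₂ : (LocalRing L v)ˣ) (hσu₂ : Units.map (conjLocal L (IsCMField.complexConj L) v : LocalRing L v →* LocalRing L v) u₂ = u₂)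
    (hu₂ : ∀ w' : PlacesOver L v, Valued.v (((u₂ : LocalRing L v) w') - 1) ≤ Valued.v ϖ ^ k) (hχu₂ : χ₁ u₂ ≠ 1)
    {r : Gqs L v} (hr : r ∈ ((cmBorelTriple L 3 v).N).map (MulAut.conj w₀).toMonoidHom)
    (hz : Valued.v ((((eA r : ↥(unitaryGroupOfForm (galAdicCompletionMap (L := L) (IsCMField.complexConj L) hw) ((StdForm.antidiagonal 3).over (w.1.adicCompletion L)))) : GL (Fin 3) (w.1.adicCompletion L)) : Matrix (Fin 3) (Fin 3) (w.1.adicCompletion L)) 2 0) ≤ 1)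
    (hoff : r ∉ Je)
    (hshal : ¬ (Valued.v ((((eA r : ↥(unitaryGroupOfForm (galAdicCompletionMap (L := L) (IsCMField.complexConj L) hw) ((StdForm.antidiagonal 3).over (w.1.adicCompletion L)))) : GL (Fin 3) (w.1.adicCompletion L)) : Matrix (Fin 3) (Fin 3) (w.1.adicCompletion L)) 2 1 /
          (((eA r : ↥(unitaryGroupOfForm (galAdicCompletionMap (L := L) (IsCMField.complexConj L) hw) ((StdForm.antidiagonal 3).over (w.1.adicCompletion L)))) : GL (Fin 3) (w.1.adicCompletion L)) : Matrix (Fin 3) (Fin 3) (w.1.adicCompletion L)) 2 0) ≤ Valued.v ϖ ^ r₁ ∧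
        (Valued.v ϖ ^ s₁)⁻¹ ≤ Valued.v ((((eA r : ↥(unitaryGroupOfForm (galAdicCompletionMap (L := L) (IsCMField.complexConj L) hw) ((StdForm.antidiagonal 3).over (w.1.adicCompletion L)))) : GL (Fin 3) (w.1.adicCompletion L)) : Matrix (Fin 3) (Fin 3) (w.1.adicCompletion L)) 2 0))) :
    ∃ (b₀ : Gqs L v) (hb₀P : ((r * b₀ * r⁻¹ : Gqs L v) : ↥(unitaryGroupOfForm (conjLocal L (IsCMField.complexConj L) v) (cmLocalForm L 3 v))) ∈ (cmBorelTriple L 3 v).P),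
      b₀ ∈ Je ∧
      (if h : IsUnit (((b₀.val : GL (Fin 3) (LocalRing L v)) : Matrix (Fin 3) (Fin 3) (LocalRing L v)) 0 0) then ((χ₁ h.unit : ℂˣ) : ℂ) else 0) ≠
        (haveI := locallyCompactSpace_cmBorelU L 3 v
         (Representation.twist
            (((Representation.trivial ℂ ↥(torusU (conjLocal L (IsCMField.complexConj L) v) (cmLocalForm L 3 v)) ℂ).twist
              (cmTorusCharPair L v χ₁ 1)).comp (cmBorelTriple L 3 v).proj) (rootDeltaChar (cmBorelTriple L 3 v).P))
          ⟨((r * b₀ * r⁻¹ : Gqs L v) : ↥(unitaryGroupOfForm (conjLocal L (IsCMField.complexConj L) v) (cmLocalForm L 3 v))), hb₀P⟩ 1) := by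
  haveI := locallyCompactSpace_cmBorelU L 3 v
  have hσσ : ∀ x, (galAdicCompletionMap (L := L) (IsCMField.complexConj L) hw) ((galAdicCompletionMap (L := L) (IsCMField.complexConj L) hw) x) = x :=
    galAdicCompletionMap_galAdicCompletionMap_of_smul_eq (IsCMField.complexConj L) w (IsCMField.complexConj_ne_one L) hw
  have hvσ : ∀ x, Valued.v (galAdicCompletionMap (L := L) (IsCMField.complexConj L) hw x) = Valued.v x :=
    fun x => valued_galAdicCompletionMap (L := L) (IsCMField.complexConj L) hw x
  have hvϖ1 : Valued.v ϖ ≤ 1 := by rw [hϖ, ← WithZero.exp_zero, WithZero.exp_le_exp]; norm_num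
  have hvϖlt : Valued.v ϖ < 1 := by rw [hϖ, ← WithZero.exp_zero, WithZero.exp_lt_exp]; norm_num
  -- the representative in the place model: `eA r = ū(x, z)`
  have hrw := map_mem_map_of_mem_map L v w hw eA heA (cmBorelTriple L 3 v) rfl w₀ hw₀ hr
  obtain ⟨x, z, hnb, hrel⟩ := K2E3LowerUnipotentBorelIwahori.exists_coe_eq_lower_of_mem_map _ rfl hσσ hrw
  have e20 : (((eA r : ↥(unitaryGroupOfForm (galAdicCompletionMap (L := L) (IsCMField.complexConj L) hw) ((StdForm.antidiagonal 3).over (w.1.adicCompletion L)))) : GL (Fin 3) (w.1.adicCompletion L)) : Matrix (Fin 3) (Fin 3) (w.1.adicCompletion L)) 2 0 = z := by rw [hnb]; rfl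
  have e21 : (((eA r : ↥(unitaryGroupOfForm (galAdicCompletionMap (L := L) (IsCMField.complexConj L) hw) ((StdForm.antidiagonal 3).over (w.1.adicCompletion L)))) : GL (Fin 3) (w.1.adicCompletion L)) : Matrix (Fin 3) (Fin 3) (w.1.adicCompletion L)) 2 1 = x := by rw [hnb]; rfl
  have hz1 : Valued.v z ≤ 1 := by rw [← e20]; exact hz
  rw [e20, e21] at hshal
  -- `eA r ∉ Jg`, in entry form
  have hoffJg : eA r ∉ Jg := fun h => hoff (by rw [hJe]; exact h)
  have hoffE : ¬ (Valued.v x ≤ Valued.v ϖ ^ r₂ ∧ Valued.v z ≤ Valued.v ϖ ^ s₂) := fun h =>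
    K2E3TwoDepthDepthWitnessCover.not_le_and_le_of_not_mem_twoDepth _ rfl hvσ hϖ r₁ s₁ r₂ s₂ Jg hJg hnb
      (h.1.trans (pow_le_one' hvϖ1 _)) (h.2.trans (pow_le_one' hvϖ1 _)) hoffJg h
  -- the two exact-conductor elements `c₁ = (u₁)_w − 1 ∈ 𝔭ᵐ`, `c₂ = (u₂)_w − 1 ∈ 𝔭ᵏ` (`σ`-fixed)
  set c₁ : w.1.adicCompletion L := (u₁ : LocalRing L v) w - 1 with hc₁_def
  set c₂ : w.1.adicCompletion L := (u₂ : LocalRing L v) w - 1 with hc₂_def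
  have hσc₂ : galAdicCompletionMap (L := L) (IsCMField.complexConj L) hw c₂ = c₂ := by
    have h1 : galAdicCompletionMap (L := L) (IsCMField.complexConj L) hw ((u₂ : LocalRing L v) w) = (u₂ : LocalRing L v) w := by
      rw [← conjLocal_apply_eq_of_smul_eq (IsCMField.complexConj L) (IsCMField.complexConj_ne_one L) v w hw (u₂ : LocalRing L v)]
      have h := congrArg (fun x : (LocalRing L v)ˣ => (x : LocalRing L v) w) hσu₂
      simpa only [Units.coe_map, MonoidHom.coe_coe] using h
    rw [hc₂_def, map_sub, map_one, h1]
  have hc₁ : Valued.v c₁ ≤ Valued.v ϖ ^ m := hu₁ w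
  have hc₂ : Valued.v c₂ ≤ Valued.v ϖ ^ k := hu₂ w
  -- ★ p862713: the model witness `u ∈ N_w`, `j = ū⁻¹ u ū ∈ Jg`, `j₀₀ = (1 + c)(1 + ε)`, `c ∈ {c₁, c₂}`
  obtain ⟨u, huN, hj, c, ε, hc, hε, h00⟩ := K2E3TwoDepthDepthWitnessCover.exists_depth_witness_twoDepth _ rfl hσσ hvσ hϖ r₁ s₁ r₂ s₂ Jg hJg
    hm hkm hrr hss hr1 hr2 hs1 hs2 hal hnb hrel hz1 hoffE hshal hc₁ hσc₂ hc₂ ht hvt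
  -- the unit `u₀ ∈ {u₁, u₂}` with `(u₀)_w = 1 + c`
  obtain ⟨u₀, hu₀c, hχu₀⟩ : ∃ u₀ : (LocalRing L v)ˣ, (u₀ : LocalRing L v) w = 1 + c ∧ χ₁ u₀ ≠ 1 := by
    rcases hc with rfl | rfl
    · exact ⟨u₁, by rw [hc₁_def, add_sub_cancel], hχu₁⟩
    · exact ⟨u₂, by rw [hc₂_def, add_sub_cancel], hχu₂⟩
  have hu₀w0 : (u₀ : LocalRing L v) w ≠ 0 := by
    intro h
    have hmul : ((u₀ : LocalRing L v) * ↑u₀⁻¹) w = (1 : LocalRing L v) w := by rw [Units.mul_inv]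
    rw [Pi.mul_apply, Pi.one_apply, h, zero_mul] at hmul
    exact zero_ne_one hmul
  have h1ε : Valued.v (1 + ε) = 1 :=
    Valued.v.map_one_add_of_lt (lt_of_le_of_lt hε (pow_lt_one' hvϖlt (Nat.succ_ne_zero m)))
  have h1ε0 : (1 + ε : w.1.adicCompletion L) ≠ 0 := fun h => by rw [h, map_zero] at h1ε; exact zero_ne_one h1ε
  -- `b₀ := r⁻¹ · eA⁻¹(u) · r`, `eA b₀ = j`, `r b₀ r⁻¹ = eA⁻¹(u)`
  have hb₀J : r⁻¹ * eA.symm u * r ∈ Je := by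
    have e : r⁻¹ * eA.symm u * r = eA.symm ((eA r)⁻¹ * u * eA r) := by
      apply eA.injective
      rw [ContinuousMulEquiv.apply_symm_apply, map_mul, map_mul, map_inv, ContinuousMulEquiv.apply_symm_apply]
    rw [e]
    exact K2E3LowerUnipotentDeepCellCM.symm_mem_comap_of_mem L v w hw eA Jg Je hJe hj
  refine ⟨r⁻¹ * eA.symm u * r, ?_, hb₀J, ?_⟩
  · have e : r * (r⁻¹ * eA.symm u * r) * r⁻¹ = eA.symm u := by group
    rw [e]
    exact (cmBorelTriple L 3 v).N_le (symm_mem_N_of_mem_unipotentU L v w hw eA heA huN)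
  · -- right-hand side `= 1`
    have hN : ((r * (r⁻¹ * eA.symm u * r) * r⁻¹ : Gqs L v) : ↥(unitaryGroupOfForm (conjLocal L (IsCMField.complexConj L) v) (cmLocalForm L 3 v))) ∈
        (cmBorelTriple L 3 v).N := by
      have e : r * (r⁻¹ * eA.symm u * r) * r⁻¹ = eA.symm u := by group
      rw [e]
      exact symm_mem_N_of_mem_unipotentU L v w hw eA heA huN
    rw [tau_apply_one_eq_one_of_mem_N L v χ₁ hN]
    -- the `w`-component of `(b₀)₀₀` is `j₀₀ = (u₀)_w (1 + ε)`, a unit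
    have h00w : (((r⁻¹ * eA.symm u * r).val : GL (Fin 3) (LocalRing L v)) : Matrix (Fin 3) (Fin 3) (LocalRing L v)) 0 0 w =
        (u₀ : LocalRing L v) w * (1 + ε) := by
      rw [← coe_eA_apply L v w hw eA heA (r⁻¹ * eA.symm u * r) 0 0, map_mul, map_mul, map_inv, ContinuousMulEquiv.apply_symm_apply, h00, hu₀c]
    have hU : IsUnit (((((r⁻¹ * eA.symm u * r).val : GL (Fin 3) (LocalRing L v)) : Matrix (Fin 3) (Fin 3) (LocalRing L v)) 0 0)) :=
      isUnit_of_apply_ne_zero L v w hw _ (by rw [h00w]; exact mul_ne_zero hu₀w0 h1ε0)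
    rw [dif_pos hU]
    -- `e := unit (b₀)₀₀ · u₀⁻¹` is `≡ 1 mod 𝔭^{m+1}` at every place, hence killed by `χ₁`
    have he : ∀ w' : PlacesOver L v, Valued.v ((((hU.unit * u₀⁻¹ : (LocalRing L v)ˣ)) : LocalRing L v) w' - 1) ≤ Valued.v ϖ ^ (m + 1) := by
      intro w'
      obtain rfl := (PlacesOver.eq_of_smul_eq (IsCMField.complexConj L) (IsCMField.complexConj_ne_one L) w hw w').symm
      rw [Units.val_mul, Units.val_inv_eq_inv_val, Pi.mul_apply, Pi.inv_apply, IsUnit.unit_spec, h00w,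
        show (u₀ : LocalRing L v) w * (1 + ε) * ((u₀ : LocalRing L v) w)⁻¹ - 1 = ε by field_simp; ring]
      exact hε
    have hχe := hcond _ he
    have hunit : hU.unit = (hU.unit * u₀⁻¹) * u₀ := by rw [inv_mul_cancel_right]
    rw [hunit, map_mul, hχe, one_mul]
    intro heq
    exact hχu₀ (Units.val_eq_one.1 heq)

end Summit.HodgeConjecture.HodgeConjecture.Cruxes.H413.K2E3TwoDepthDepthWitnessCM

end
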